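import Summits.ABC.IUTFork.Repair.RHOffRemainderToleranceSUnit
import HarnessLib

/-!
# R-H PAIR-5 TESTER, part 4/4: the GENERIC WITNESS and the [TOL] / [TOL♯] binders of the equivalence rows' ends
# `SigmaStrataEq.abc_of_offRemainder_sigmaNu_le_tol(Sharp)` (p471150) are FALSE in the kernel, VERBATIM

abc-iut cell, rung LADDER-ABC:A2.RESCUE.H, R-H pair-5 TESTER seat abc-iut-rh-tst-5 (gen 4; content) — filed by proxy (abc-iut-rh-typ-5, bytes only).
PROOF-ONLY record file (D-0012: 0 definitions, 0 `Prop` facts, 0 sorries; axioms `propext`, `Classical.choice`, `Quot.sound`). Part 4 of the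
¬[TOL] record whose parts 1–3 are `RHOffRemainderToleranceMechanism.lean` (§§1–3), `RHOffRemainderToleranceSUnit.lean` (§4: the S-unit family at
the deep slot-constant prime `7`, `datum_offRemainder_empty_ge`) and `RHOffRemainderToleranceRefutation.lean` (§5: row 5's Σ₅ binder,
`not_offRemainder_sigmaFive_le_tol`); the mechanism, the honest framing and the classification are stated in part 1's header and hold here verbatim.
The context functions `M, archPk, …, qData` are ONE `variable` block (the 47-line block of `RHSigmaStrataAbcRecut.lean` §Recut, byte-identical to
the explicit binders of the abc-ends), so every `¬ ⟨binder⟩` below has LITERALLY the binder's type.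

## Results (namespace `Summit.ABC.IUTFork.Repair.RH.OffRemainderTolerance`)
* **`exists_admissible_datum_lt_offRemainder_empty`** — THE GENERIC WITNESS: at every fixed prime `l ≥ 11`, for every choice of the context
  functions and every real `τ`, there are an admissible `P ∈ UP` (core, (P2), (P5), (P6)) with `d_mod(P) = 2` and a genuine Θ-volume datum
  `T` of `(P, l)` with `τ < R_∅(T)` at the chosen realising ideles. EVERY ∀-T binder «`R_Σ(T) ≤ f(d_mod, l)`» on a stratum with
  `R_Σ(T) = R_∅(T)` at the chosen ideles dies on it in five lines (recipe: `obtain ⟨P, T, …, hd, hgt⟩ := …; have hle := hTol P …; rw [<strata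
  identity>, hd] at hle; exact absurd hle (not_le.mpr hgt)`).
* **`not_offRemainder_sigmaNu_le_tol`** (+ `_at_prime`, every fixed prime `l ≥ 11`) — the [TOL] binder of rh2-q2-eq's
  `SigmaStrataEq.abc_of_offRemainder_sigmaNu_le_tol` (p471150, rows 3/4/5; the same text is the [TOL] of the recut
  `abc_of_offRemainder_sigmaNu_le_tol_hregBad`), VERBATIM, is FALSE (`R_{Σ₄}(T) = R_∅(T)`: `offRemainder_sigmaNu_chosen_eq_offRemainder_empty`).
* **`not_offRemainder_sigmaNu_le_tolSharp`** (+ `_at_prime`) — the same for the SHARP tolerance [TOL♯] of `abc_of_offRemainder_sigmaNu_le_tolSharp`.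

CLASS (refuter protocol) `refuted-misstated` for both: the witness (a FIXED `l` against points of unbounded height) exploits the absence of print's
coupling of `l` to the height / of a guard; REPAIRED statements of record, all MISSED by this witness: the Szpiro-bad-guarded recuts
`abc_of_offRemainder_sigmaNu_le_tol_szpiroBad_hregBad`, `abc_of_offRemainder_empty_le_tol(Sharp)_szpiroBad_hregBad` (a generic `P_{a,c}` is
Szpiro-GOOD, abc-iut-s2-p4 `szpiroBad_iff_log_discr_lt`) and the window / ρ ends `abc_of_offRemainder_sigmaNu_window` / `…_rho_window` (their
[TOL, WINDOW] binder carries the off-depth-locus guard, which deep members of the family fail; the ρ-window `√(log q∀) ≤ l` is left at fixed `l`).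
NOT IN SCOPE: content-guarded [TOL-C]/[MU-C] ends, pilot-gap and weighted-mass carriers.
HONEST FRAMING: «these typed binders are false AS TYPED», nothing more; nothing here asserts that abc is proved or refuted, or that [IUTchIII]
Cor. 3.12 holds or fails at any datum; no side taken on any author; typed ≠ proved; instantiated ≠ endorsed; refuted-as-typed ≠ refuted-in-print.
[cite: Mochizuki2012, IUTchIV Thm. 1.10 pp. 22–31, Step (v) pp. 27–28; Cor. 2.2 (ii)–(iii) pp. 41–48] [cite: Mochizuki2012, IUTchIII Cor. 3.12 p. 174]
[cite: DupuyHilado2025, §3.3, §3.6] [claim: Mochizuki2012, status: disputed] for every IUT quotation.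
-/

noncomputable section

open Set Function NumberField IsDedekindDomain
open scoped Pointwise

namespace Summit.ABC.IUTFork.Repair.RH.OffRemainderTolerance

open Summit.ABC.IUTFork.Thm311 Summit.ABC.IUTFork.Thm311.Real Summit.ABC.IUTFork.Cor312 Summit.ABC.IUTFork.Cor312.Setting
  Summit.ABC.IUTFork.Cor312Vol Summit.ABC.IUTFork.Cor312Prov Summit.ABC.IUTFork.Repair.RH.SigmaLicence
  Literature.IUT.LogThetaLattice Literature.IUT.LogVolume Literature.IUT.HodgeTheaters Literature.NumberTheory.NumberFields
  Summit.ABC.IUTFork.SUnitFamily Literature.NumberTheory.DiophantineGeometry.GenEll Summit.ABC.ABC.Theorems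
  Summit.ABC.IUTFork.PointDict Summit.ABC.IUTFork.Conditional Literature.IUT.LogVolume.ThetaData
  Summit.ABC.IUTFork.Repair.RH.SigmaStrataEq Summit.ABC.IUTFork.Repair.RH

section Witness

variable
    (M : ∀ (P : NFPoint) (l : ℕ) (T : Cor22.ThetaVolumeDatumAt P l), Type) [∀ P l T, Field (M P l T)] [∀ P l T, NumberField (M P l T)]
    (archPk : ∀ (P : NFPoint) (l : ℕ) (T : Cor22.ThetaVolumeDatumAt P l), letI := T.instFieldF; letI := T.instNumberFieldF; letI := T.instAlgebraF; letI := T.instFieldK;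
        letI := T.instNumberFieldK; letI := T.instAlgebraK; letI := T.instFieldFbar; letI := T.instAlgebraFbar;
        letI := T.instAlgebraKFbar; letI := T.instIsElliptic;
      ∀ (j : (thetaIndex (pilotDataOfK T.D T.K)).Label) (vQ : (thetaIndex (pilotDataOfK T.D T.K)).VQ), Set ((logShellsDH (pilotDataOfK T.D T.K) (analyticLogv T.K)).Packet j vQ))
    (archSub : ∀ (P : NFPoint) (l : ℕ) (T : Cor22.ThetaVolumeDatumAt P l), letI := T.instFieldF; letI := T.instNumberFieldF; letI := T.instAlgebraF; letI := T.instFieldK;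
        letI := T.instNumberFieldK; letI := T.instAlgebraK; letI := T.instFieldFbar; letI := T.instAlgebraFbar;
        letI := T.instAlgebraKFbar; letI := T.instIsElliptic;
      ∀ (j : (thetaIndex (pilotDataOfK T.D T.K)).Label) (v : (thetaIndex (pilotDataOfK T.D T.K)).V), Set ((logShellsDH (pilotDataOfK T.D T.K) (analyticLogv T.K)).Packet j ((thetaIndex (pilotDataOfK T.D T.K)).over v)))
    (Ψ : ∀ (P : NFPoint) (l : ℕ) (T : Cor22.ThetaVolumeDatumAt P l), letI := T.instFieldF; letI := T.instNumberFieldF; letI := T.instAlgebraF; letI := T.instFieldK;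
        letI := T.instNumberFieldK; letI := T.instAlgebraK; letI := T.instFieldFbar; letI := T.instAlgebraFbar;
        letI := T.instAlgebraKFbar; letI := T.instIsElliptic;
      ℤ → ∀ v : (thetaIndex (pilotDataOfK T.D T.K)).V, v ∈ (thetaIndex (pilotDataOfK T.D T.K)).Vbad → Set ((logShellsDH (pilotDataOfK T.D T.K) (analyticLogv T.K)).StarPacket v))
    (act : ∀ (P : NFPoint) (l : ℕ) (T : Cor22.ThetaVolumeDatumAt P l), letI := T.instFieldF; letI := T.instNumberFieldF; letI := T.instAlgebraF; letI := T.instFieldK;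
        letI := T.instNumberFieldK; letI := T.instAlgebraK; letI := T.instFieldFbar; letI := T.instAlgebraFbar;
        letI := T.instAlgebraKFbar; letI := T.instIsElliptic;
      ℤ → ∀ v : (thetaIndex (pilotDataOfK T.D T.K)).V, v ∈ (thetaIndex (pilotDataOfK T.D T.K)).Vbad → (logShellsDH (pilotDataOfK T.D T.K) (analyticLogv T.K)).StarPacket v → Module.End ℚ ((logShellsDH (pilotDataOfK T.D T.K) (analyticLogv T.K)).StarPacket v))
    (Mmod : ∀ (P : NFPoint) (l : ℕ) (T : Cor22.ThetaVolumeDatumAt P l), letI := T.instFieldF; letI := T.instNumberFieldF; letI := T.instAlgebraF; letI := T.instFieldK;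
        letI := T.instNumberFieldK; letI := T.instAlgebraK; letI := T.instFieldFbar; letI := T.instAlgebraFbar;
        letI := T.instAlgebraKFbar; letI := T.instIsElliptic;
      ℤ → ∀ j : (thetaIndex (pilotDataOfK T.D T.K)).LabelStar, Set ((logShellsDH (pilotDataOfK T.D T.K) (analyticLogv T.K)).GlobalPacket j.1))
    (region : ∀ (P : NFPoint) (l : ℕ) (T : Cor22.ThetaVolumeDatumAt P l), letI := T.instFieldF; letI := T.instNumberFieldF; letI := T.instAlgebraF; letI := T.instFieldK;
        letI := T.instNumberFieldK; letI := T.instAlgebraK; letI := T.instFieldFbar; letI := T.instAlgebraFbar;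
        letI := T.instAlgebraKFbar; letI := T.instIsElliptic;
      ℤ → ∀ j : (thetaIndex (pilotDataOfK T.D T.K)).LabelStar, FinDivisor (M P l T) → ∀ vQ : (thetaIndex (pilotDataOfK T.D T.K)).VQ, Set ((logShellsDH (pilotDataOfK T.D T.K) (analyticLogv T.K)).Packet j.1 vQ))
    (n : ∀ (P : NFPoint) (l : ℕ) (T : Cor22.ThetaVolumeDatumAt P l), ℤ)
    {HT : ∀ (P : NFPoint) (l : ℕ) (T : Cor22.ThetaVolumeDatumAt P l), Type} {LogLink : ∀ (P : NFPoint) (l : ℕ) (T : Cor22.ThetaVolumeDatumAt P l), HT P l T → HT P l T → Type}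
    {IsFull : ∀ (P : NFPoint) (l : ℕ) (T : Cor22.ThetaVolumeDatumAt P l), ∀ {s t : HT P l T}, LogLink P l T s t → Prop}
    (lat : ∀ (P : NFPoint) (l : ℕ) (T : Cor22.ThetaVolumeDatumAt P l), LGPGaussianLogThetaLattice (LogLink P l T) (IsFull P l T))
    {Frd : ∀ (P : NFPoint) (l : ℕ) (T : Cor22.ThetaVolumeDatumAt P l), Type} {IsoF : ∀ (P : NFPoint) (l : ℕ) (T : Cor22.ThetaVolumeDatumAt P l), Frd P l T → Frd P l T → Type} {Ob : ∀ (P : NFPoint) (l : ℕ) (T : Cor22.ThetaVolumeDatumAt P l), Frd P l T → Type}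
    {realify : ∀ (P : NFPoint) (l : ℕ) (T : Cor22.ThetaVolumeDatumAt P l), Frd P l T → Frd P l T} {Strip : ∀ (P : NFPoint) (l : ℕ) (T : Cor22.ThetaVolumeDatumAt P l), Type} {IsoS : ∀ (P : NFPoint) (l : ℕ) (T : Cor22.ThetaVolumeDatumAt P l), Strip P l T → Strip P l T → Type}
    {Mv : ∀ (P : NFPoint) (l : ℕ) (T : Cor22.ThetaVolumeDatumAt P l), letI := T.instFieldF; letI := T.instNumberFieldF; letI := T.instAlgebraF; letI := T.instFieldK;
        letI := T.instNumberFieldK; letI := T.instAlgebraK; letI := T.instFieldFbar; letI := T.instAlgebraFbar;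
        letI := T.instAlgebraKFbar; letI := T.instIsElliptic;
      ∀ v : (thetaIndex (pilotDataOfK T.D T.K)).V, v ∈ (thetaIndex (pilotDataOfK T.D T.K)).Vbad → Type}
    [∀ P l T v h, Monoid (Mv P l T v h)]
    (sig : ∀ (P : NFPoint) (l : ℕ) (T : Cor22.ThetaVolumeDatumAt P l), letI := T.instFieldF; letI := T.instNumberFieldF; letI := T.instAlgebraF; letI := T.instFieldK;
        letI := T.instNumberFieldK; letI := T.instAlgebraK; letI := T.instFieldFbar; letI := T.instAlgebraFbar;
        letI := T.instAlgebraKFbar; letI := T.instIsElliptic;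
      GlobalLGPFrobenioidSignature (thetaIndex (pilotDataOfK T.D T.K)).lstar (thetaIndex (pilotDataOfK T.D T.K)).V (· ∈ (thetaIndex (pilotDataOfK T.D T.K)).Vbad) (Frd P l T) (IsoF P l T) (Ob P l T) (realify P l T)
        (Strip P l T) (IsoS P l T) (Mv P l T))
    (split : ∀ (P : NFPoint) (l : ℕ) (T : Cor22.ThetaVolumeDatumAt P l), SplittingMonoids (Mv P l T))
    {ObΔ : ∀ (P : NFPoint) (l : ℕ) (T : Cor22.ThetaVolumeDatumAt P l), Type} {N : ∀ (P : NFPoint) (l : ℕ) (T : Cor22.ThetaVolumeDatumAt P l), letI := T.instFieldF; letI := T.instNumberFieldF; letI := T.instAlgebraF; letI := T.instFieldK;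
        letI := T.instNumberFieldK; letI := T.instAlgebraK; letI := T.instFieldFbar; letI := T.instAlgebraFbar;
        letI := T.instAlgebraKFbar; letI := T.instIsElliptic;
      ∀ v : (thetaIndex (pilotDataOfK T.D T.K)).V, v ∈ (thetaIndex (pilotDataOfK T.D T.K)).Vbad → Type}
    [∀ P l T v h, Monoid (N P l T v h)] (qData : ∀ (P : NFPoint) (l : ℕ) (T : Cor22.ThetaVolumeDatumAt P l), QPilotData (ObΔ P l T) (N P l T))

/-- **THE GENERIC WITNESS: at every fixed prime `l ≥ 11`, `R_∅(T)` at the chosen realising ideles is UNBOUNDED over the admissible data with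
`d_mod = 2`** (for every choice of the context functions). For every real `τ` there are an admissible `P ∈ UP` at `l` (minimally presented, core,
(P2), (P5), (P6) — an S-unit point `P_{a,c}` of abc-iut-s2-p4, `a, c ≡ 1 (mod l)`, `7^c ≤ 5^a ≤ 5^l·7^c`, `c` large; (P6) by
`Cor22.condP6_of_seven_le` on `K_∞(5^l)`) with `d_mod(P) = 2` and a genuine Θ-volume datum `T` of `(P, l)` (`ThetaPartII.stub_thetaData`, PROVED)
with `τ < R_∅(T)` (part 2's `datum_offRemainder_empty_ge`: slope `(l(l+1)/12 − 1)·log 7/l > 0` in `c`). A statement about OUR typed objects; no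
side taken. [cite: Mochizuki2012, IUTchIV Thm. 1.10 Step (v)–(viii) pp. 27–29; Cor. 2.2 (ii) proof (P1)–(P7) pp. 45–46]
[claim: Mochizuki2012, status: disputed] -/
theorem exists_admissible_datum_lt_offRemainder_empty {l : ℕ} (hl : l.Prime) (h11 : 11 ≤ l) (τ : ℝ) :
    ∃ (P : NFPoint) (T : Cor22.ThetaVolumeDatumAt P l), P ∈ UP ∧ Cor22.AdmitsCore P ∧ Cor22.CondP2 P l ∧ Cor22.CondP5 P l ∧
      Cor22.CondP6 P l ∧ Cor22.dmod P = 2 ∧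
      (letI := T.instFieldF; letI := T.instNumberFieldF; letI := T.instAlgebraF; letI := T.instFieldK;
       letI := T.instNumberFieldK; letI := T.instAlgebraK; letI := T.instFieldFbar; letI := T.instAlgebraFbar;
       letI := T.instAlgebraKFbar; letI := T.instIsElliptic;
       τ < offRemainder
        (settingPrVolSharp (pilotDataOfK T.D T.K) (logvAnalytic_analyticLogv (F := T.K)) (M P l T) (archPk P l T) (archSub P l T) (Ψ P l T)
          (act P l T) (Mmod P l T) (region P l T) (n P l T) (lat P l T) (sig P l T) (split P l T) (qData P l T)
          (exists_realising_qIdeles_pilotDataOfK T.D).choose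
          (exists_realising_thetaIdeles_pilotDataOfK T.D).choose
          (exists_realising_qIdeles_pilotDataOfK T.D).choose_spec.1
          (exists_realising_qIdeles_pilotDataOfK T.D).choose_spec.2.1) ∅) := by
  have hl2 : 2 ≤ l := hl.two_le
  have hl5 : 5 ≤ l := by omega
  have hl5' : l ≠ 5 := by omega
  have hlne2 : l ≠ 2 := by omega
  have hl7 : 7 ≤ l := by omega
  have hlr : (11 : ℝ) ≤ (l : ℝ) := by exact_mod_cast h11
  have hl0 : (0 : ℝ) < (l : ℝ) := by linarith
  have hlog5 : 0 < Real.log 5 := Real.log_pos (by norm_num)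
  have hlog7 : 0 < Real.log 7 := Real.log_pos (by norm_num)
  obtain ⟨R, hRdef⟩ : ∃ R : ℝ, R = (5 : ℝ) ^ l := ⟨_, rfl⟩
  have hR : 1 ≤ R := hRdef ▸ one_le_pow₀ (by norm_num)
  obtain ⟨HK, hHK⟩ := Cor22.condP6_of_seven_le (cbTwoDiscs R hR)
  -- the slope of the datum lower bound in `c` and the `l`-only constant
  obtain ⟨s, hsdef⟩ : ∃ s : ℝ, s = ((l : ℝ) * ((l : ℝ) + 1) / 12 - 1) * (Real.log 7 / l) := ⟨_, rfl⟩
  have hs : 0 < s := by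
    have h1 : (0 : ℝ) < (l : ℝ) * ((l : ℝ) + 1) / 12 - 1 := by nlinarith
    rw [hsdef]
    exact mul_pos h1 (div_pos hlog7 hl0)
  obtain ⟨Cl, hCl⟩ : ∃ Cl : ℝ, Cl = 2 * (((l : ℝ) + 5) / 4 * (Real.log 7 + 2 * Real.log (368640 * (l : ℝ) ^ 4) + 3)) + Real.log 7 :=
    ⟨_, rfl⟩
  -- choose the exponents
  obtain ⟨m, hm⟩ := exists_nat_gt (max (HK / Real.log 5) ((Cl + τ) / s))
  obtain ⟨a, c, ha, hc, hla, hlc, hlo, hhi⟩ := exists_exponents l hl2 m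
  have ha1 : 1 ≤ a := by omega
  have hc1 : 1 ≤ c := by omega
  have hbigA : HK < (a : ℝ) * Real.log 5 := by
    have h1 : HK / Real.log 5 < m := lt_of_le_of_lt (le_max_left _ _) hm
    rw [div_lt_iff₀ hlog5] at h1
    have h2 : (m : ℝ) * Real.log 5 ≤ (a : ℝ) * Real.log 5 :=
      mul_le_mul_of_nonneg_right (by exact_mod_cast (by omega : m ≤ a)) hlog5.le
    linarith
  have hbigC : Cl + τ < (c : ℝ) * s := by
    have h1 : (Cl + τ) / s < m := lt_of_le_of_lt (le_max_right _ _) hm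
    rw [div_lt_iff₀ hs] at h1
    have h2 : (m : ℝ) * s ≤ (c : ℝ) * s := mul_le_mul_of_nonneg_right (by exact_mod_cast (by omega : m ≤ c)) hs.le
    linarith
  -- admissibility of `P_{a,c}` at `l`
  have hP : Pt a c ∈ UP := P_mem_UP ha1 hc1
  have hcore : Cor22.AdmitsCore (Pt a c) := admitsCore_P ha1 hc1
  have h2 : Cor22.CondP2 (Pt a c) l := condP2_P ha1 hc1 hl hlne2 hla hlc
  have h5 : Cor22.CondP5 (Pt a c) l := condP5_P ha1 hc1 hl hl5'
  have hd : Cor22.dmod (Pt a c) = 2 := dmod_P ha1 hc1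
  have hmem : Pt a c ∈ (cbTwoDiscs R hR).toSet :=
    P_mem_cbTwoDiscs (a := a) (c := c) hR (by exact_mod_cast hlo) (by rw [hRdef]; exact_mod_cast hhi)
  have hq : (a : ℝ) * Real.log 5 ≤ Cor22.logQForall (Pt a c) := le_logQForall_P ha1 hc1
  have h6 : Cor22.CondP6 (Pt a c) l := hHK (Pt a c) hmem hP l hl hl7 h2 h5 (by linarith)
  -- a genuine datum and the datum lower bound there
  obtain ⟨T⟩ := ThetaPartII.stub_thetaData (Pt a c) hP l hl hl5 hcore h2 h5 h6
  refine ⟨Pt a c, T, hP, hcore, h2, h5, h6, hd, ?_⟩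
  letI := T.instFieldF; letI := T.instNumberFieldF; letI := T.instAlgebraF; letI := T.instFieldK
  letI := T.instNumberFieldK; letI := T.instAlgebraK; letI := T.instFieldFbar; letI := T.instAlgebraFbar
  letI := T.instAlgebraKFbar; letI := T.instIsElliptic
  have hge := datum_offRemainder_empty_ge ha1 hc1 hl h11 T (M (Pt a c) l T)
    (archPk (Pt a c) l T) (archSub (Pt a c) l T) (Ψ (Pt a c) l T) (act (Pt a c) l T) (Mmod (Pt a c) l T) (region (Pt a c) l T)
    (n (Pt a c) l T) (lat (Pt a c) l T) (sig (Pt a c) l T) (split (Pt a c) l T) (qData (Pt a c) l T)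
    (exists_realising_qIdeles_pilotDataOfK T.D).choose (exists_realising_thetaIdeles_pilotDataOfK T.D).choose
    (exists_realising_qIdeles_pilotDataOfK T.D).choose_spec.1 (exists_realising_qIdeles_pilotDataOfK T.D).choose_spec.2.1
    (exists_realising_thetaIdeles_pilotDataOfK T.D).choose_spec.1 (exists_realising_thetaIdeles_pilotDataOfK T.D).choose_spec.2.2
    (exists_realising_qIdeles_pilotDataOfK T.D).choose_spec.2.2
  have hring : ((l : ℝ) * ((l : ℝ) + 1) / 12 - 1) * ((c : ℝ) / l * Real.log 7) = (c : ℝ) * s := by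
    rw [hsdef]; ring
  refine lt_of_lt_of_le ?_ hge
  linarith

/-- **THE `l`-SLICE OF THE EQUIVALENCE ROWS' [TOL] (Σ₄ = `sigmaNu`) IS FALSE AT EVERY FIXED PRIME `l ≥ 11`**: the generic witness + rh2-q2-eq's
`SigmaStrataEq.offRemainder_sigmaNu_chosen_eq_offRemainder_empty` (`R_{Σ₄}(T) = R_∅(T)` at the chosen ideles); the tolerance is a function of
`(d_mod, l)` alone. No side taken. [cite: Mochizuki2012, IUTchIV Thm. 1.10 pp. 22–31] [claim: Mochizuki2012, status: disputed] -/
theorem not_offRemainder_sigmaNu_le_tol_at_prime {l : ℕ} (hl : l.Prime) (h11 : 11 ≤ l) :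
    ¬ (∀ P : NFPoint, P ∈ UP → Cor22.AdmitsCore P → Cor22.CondP2 P l → Cor22.CondP5 P l → Cor22.CondP6 P l →
      ∀ T : Cor22.ThetaVolumeDatumAt P l, letI := T.instFieldF; letI := T.instNumberFieldF; letI := T.instAlgebraF; letI := T.instFieldK;
        letI := T.instNumberFieldK; letI := T.instAlgebraK; letI := T.instFieldFbar; letI := T.instAlgebraFbar;
        letI := T.instAlgebraKFbar; letI := T.instIsElliptic;
      offRemainder
        (settingPrVolSharp (pilotDataOfK T.D T.K) (logvAnalytic_analyticLogv (F := T.K)) (M P l T) (archPk P l T) (archSub P l T) (Ψ P l T)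
          (act P l T) (Mmod P l T) (region P l T) (n P l T) (lat P l T) (sig P l T) (split P l T) (qData P l T)
          (exists_realising_qIdeles_pilotDataOfK T.D).choose
          (exists_realising_thetaIdeles_pilotDataOfK T.D).choose
          (exists_realising_qIdeles_pilotDataOfK T.D).choose_spec.1
          (exists_realising_qIdeles_pilotDataOfK T.D).choose_spec.2.1)
        (sigmaNu (pilotDataOfK T.D T.K) (logvAnalytic_analyticLogv (F := T.K)) (M P l T) (archPk P l T) (archSub P l T) (Ψ P l T)
          (act P l T) (Mmod P l T) (region P l T) (n P l T) (lat P l T) (sig P l T) (split P l T) (qData P l T)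
          (exists_realising_qIdeles_pilotDataOfK T.D).choose
          (exists_realising_thetaIdeles_pilotDataOfK T.D).choose
          (exists_realising_qIdeles_pilotDataOfK T.D).choose_spec.1
          (exists_realising_qIdeles_pilotDataOfK T.D).choose_spec.2.1) ≤
        ((l : ℝ) + 1) / 4 * (5 * ((((2 ^ 12 * 3 ^ 3 * 5 * Cor22.dmod P : ℕ) : ℝ)) * l))) := by
  intro hvol
  obtain ⟨P, T, hP, hcore, h2, h5, h6, hd, hgt⟩ := exists_admissible_datum_lt_offRemainder_empty M archPk archSub Ψ act Mmod region n lat sig split qData hl h11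
    (((l : ℝ) + 1) / 4 * (5 * ((((2 ^ 12 * 3 ^ 3 * 5 * 2 : ℕ) : ℝ)) * l)))
  have hle := hvol P hP hcore h2 h5 h6 T
  letI := T.instFieldF; letI := T.instNumberFieldF; letI := T.instAlgebraF; letI := T.instFieldK
  letI := T.instNumberFieldK; letI := T.instAlgebraK; letI := T.instFieldFbar; letI := T.instAlgebraFbar
  letI := T.instAlgebraKFbar; letI := T.instIsElliptic
  rw [offRemainder_sigmaNu_chosen_eq_offRemainder_empty T (M P l T) (archPk P l T) (archSub P l T) (Ψ P l T) (act P l T) (Mmod P l T) (region P l T) (n P l T) (lat P l T) (sig P l T) (split P l T) (qData P l T), hd] at hle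
  exact absurd hle (not_le.mpr hgt)

/-- **THE [TOL] BINDER OF rh2-q2-eq's `SigmaStrataEq.abc_of_offRemainder_sigmaNu_le_tol` (p471150, rows 3/4/5; the same text is the [TOL] of the
recut `abc_of_offRemainder_sigmaNu_le_tol_hregBad`) IS FALSE, VERBATIM** — already its `l = 11` slice is. CLASS `refuted-misstated`; repaired
statements of record (Szpiro-bad recuts, window / ρ ends) MISSED by this witness — see the header. No side taken; «false AS TYPED», nothing more.
[cite: Mochizuki2012, IUTchIV Thm. 1.10 pp. 22–31] [claim: Mochizuki2012, status: disputed] -/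
theorem not_offRemainder_sigmaNu_le_tol :
    ¬ (∀ P : NFPoint, P ∈ UP → ∀ l : ℕ, l.Prime → 5 ≤ l →
      Cor22.AdmitsCore P → Cor22.CondP2 P l → Cor22.CondP5 P l → Cor22.CondP6 P l →
      ∀ T : Cor22.ThetaVolumeDatumAt P l, letI := T.instFieldF; letI := T.instNumberFieldF; letI := T.instAlgebraF; letI := T.instFieldK;
        letI := T.instNumberFieldK; letI := T.instAlgebraK; letI := T.instFieldFbar; letI := T.instAlgebraFbar;
        letI := T.instAlgebraKFbar; letI := T.instIsElliptic;
      offRemainder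
        (settingPrVolSharp (pilotDataOfK T.D T.K) (logvAnalytic_analyticLogv (F := T.K)) (M P l T) (archPk P l T) (archSub P l T) (Ψ P l T)
          (act P l T) (Mmod P l T) (region P l T) (n P l T) (lat P l T) (sig P l T) (split P l T) (qData P l T)
          (exists_realising_qIdeles_pilotDataOfK T.D).choose
          (exists_realising_thetaIdeles_pilotDataOfK T.D).choose
          (exists_realising_qIdeles_pilotDataOfK T.D).choose_spec.1
          (exists_realising_qIdeles_pilotDataOfK T.D).choose_spec.2.1)
        (sigmaNu (pilotDataOfK T.D T.K) (logvAnalytic_analyticLogv (F := T.K)) (M P l T) (archPk P l T) (archSub P l T) (Ψ P l T)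
          (act P l T) (Mmod P l T) (region P l T) (n P l T) (lat P l T) (sig P l T) (split P l T) (qData P l T)
          (exists_realising_qIdeles_pilotDataOfK T.D).choose
          (exists_realising_thetaIdeles_pilotDataOfK T.D).choose
          (exists_realising_qIdeles_pilotDataOfK T.D).choose_spec.1
          (exists_realising_qIdeles_pilotDataOfK T.D).choose_spec.2.1) ≤
        ((l : ℝ) + 1) / 4 * (5 * ((((2 ^ 12 * 3 ^ 3 * 5 * Cor22.dmod P : ℕ) : ℝ)) * l))) :=
  fun h => not_offRemainder_sigmaNu_le_tol_at_prime M archPk archSub Ψ act Mmod region n lat sig split qData (l := 11) (by norm_num) le_rfl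
    fun P hP hcore h2 h5 h6 T => h P hP 11 (by norm_num) (by norm_num) hcore h2 h5 h6 T

/-- **THE `l`-SLICE OF THE SHARP TOLERANCE [TOL♯] (Σ₄; `(20·(1 − 12/l²) − 84/9)` in place of `5`) IS FALSE AT EVERY FIXED PRIME `l ≥ 11`** —
any tolerance that is a function of `(d_mod, l)` alone dies on the generic witness. No side taken. [claim: Mochizuki2012, status: disputed] -/
theorem not_offRemainder_sigmaNu_le_tolSharp_at_prime {l : ℕ} (hl : l.Prime) (h11 : 11 ≤ l) :
    ¬ (∀ P : NFPoint, P ∈ UP → Cor22.AdmitsCore P → Cor22.CondP2 P l → Cor22.CondP5 P l → Cor22.CondP6 P l →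
      ∀ T : Cor22.ThetaVolumeDatumAt P l, letI := T.instFieldF; letI := T.instNumberFieldF; letI := T.instAlgebraF; letI := T.instFieldK;
        letI := T.instNumberFieldK; letI := T.instAlgebraK; letI := T.instFieldFbar; letI := T.instAlgebraFbar;
        letI := T.instAlgebraKFbar; letI := T.instIsElliptic;
      offRemainder
        (settingPrVolSharp (pilotDataOfK T.D T.K) (logvAnalytic_analyticLogv (F := T.K)) (M P l T) (archPk P l T) (archSub P l T) (Ψ P l T)
          (act P l T) (Mmod P l T) (region P l T) (n P l T) (lat P l T) (sig P l T) (split P l T) (qData P l T)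
          (exists_realising_qIdeles_pilotDataOfK T.D).choose
          (exists_realising_thetaIdeles_pilotDataOfK T.D).choose
          (exists_realising_qIdeles_pilotDataOfK T.D).choose_spec.1
          (exists_realising_qIdeles_pilotDataOfK T.D).choose_spec.2.1)
        (sigmaNu (pilotDataOfK T.D T.K) (logvAnalytic_analyticLogv (F := T.K)) (M P l T) (archPk P l T) (archSub P l T) (Ψ P l T)
          (act P l T) (Mmod P l T) (region P l T) (n P l T) (lat P l T) (sig P l T) (split P l T) (qData P l T)
          (exists_realising_qIdeles_pilotDataOfK T.D).choose
          (exists_realising_thetaIdeles_pilotDataOfK T.D).choose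
          (exists_realising_qIdeles_pilotDataOfK T.D).choose_spec.1
          (exists_realising_qIdeles_pilotDataOfK T.D).choose_spec.2.1) ≤
        ((l : ℝ) + 1) / 4 * ((20 * (1 - 12 / (l : ℝ) ^ 2) - 84 / 9) * ((((2 ^ 12 * 3 ^ 3 * 5 * Cor22.dmod P : ℕ) : ℝ)) * l))) := by
  intro hvol
  obtain ⟨P, T, hP, hcore, h2, h5, h6, hd, hgt⟩ := exists_admissible_datum_lt_offRemainder_empty M archPk archSub Ψ act Mmod region n lat sig split qData hl h11
    (((l : ℝ) + 1) / 4 * ((20 * (1 - 12 / (l : ℝ) ^ 2) - 84 / 9) * ((((2 ^ 12 * 3 ^ 3 * 5 * 2 : ℕ) : ℝ)) * l)))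
  have hle := hvol P hP hcore h2 h5 h6 T
  letI := T.instFieldF; letI := T.instNumberFieldF; letI := T.instAlgebraF; letI := T.instFieldK
  letI := T.instNumberFieldK; letI := T.instAlgebraK; letI := T.instFieldFbar; letI := T.instAlgebraFbar
  letI := T.instAlgebraKFbar; letI := T.instIsElliptic
  rw [offRemainder_sigmaNu_chosen_eq_offRemainder_empty T (M P l T) (archPk P l T) (archSub P l T) (Ψ P l T) (act P l T) (Mmod P l T) (region P l T) (n P l T) (lat P l T) (sig P l T) (split P l T) (qData P l T), hd] at hle
  exact absurd hle (not_le.mpr hgt)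

/-- **THE [TOL♯] BINDER OF rh2-q2-eq's `SigmaStrataEq.abc_of_offRemainder_sigmaNu_le_tolSharp` IS FALSE, VERBATIM** — already its `l = 11` slice is.
CLASS `refuted-misstated`; repaired statement of record = `abc_of_offRemainder_empty_le_tolSharp_szpiroBad_hregBad` (Szpiro-bad guard; MISSED).
No side taken; «false AS TYPED», nothing more. [cite: Mochizuki2012, IUTchIV Thm. 1.10 pp. 22–31] [claim: Mochizuki2012, status: disputed] -/
theorem not_offRemainder_sigmaNu_le_tolSharp :
    ¬ (∀ P : NFPoint, P ∈ UP → ∀ l : ℕ, l.Prime → 5 ≤ l →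
      Cor22.AdmitsCore P → Cor22.CondP2 P l → Cor22.CondP5 P l → Cor22.CondP6 P l →
      ∀ T : Cor22.ThetaVolumeDatumAt P l, letI := T.instFieldF; letI := T.instNumberFieldF; letI := T.instAlgebraF; letI := T.instFieldK;
        letI := T.instNumberFieldK; letI := T.instAlgebraK; letI := T.instFieldFbar; letI := T.instAlgebraFbar;
        letI := T.instAlgebraKFbar; letI := T.instIsElliptic;
      offRemainder
        (settingPrVolSharp (pilotDataOfK T.D T.K) (logvAnalytic_analyticLogv (F := T.K)) (M P l T) (archPk P l T) (archSub P l T) (Ψ P l T)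
          (act P l T) (Mmod P l T) (region P l T) (n P l T) (lat P l T) (sig P l T) (split P l T) (qData P l T)
          (exists_realising_qIdeles_pilotDataOfK T.D).choose
          (exists_realising_thetaIdeles_pilotDataOfK T.D).choose
          (exists_realising_qIdeles_pilotDataOfK T.D).choose_spec.1
          (exists_realising_qIdeles_pilotDataOfK T.D).choose_spec.2.1)
        (sigmaNu (pilotDataOfK T.D T.K) (logvAnalytic_analyticLogv (F := T.K)) (M P l T) (archPk P l T) (archSub P l T) (Ψ P l T)
          (act P l T) (Mmod P l T) (region P l T) (n P l T) (lat P l T) (sig P l T) (split P l T) (qData P l T)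
          (exists_realising_qIdeles_pilotDataOfK T.D).choose
          (exists_realising_thetaIdeles_pilotDataOfK T.D).choose
          (exists_realising_qIdeles_pilotDataOfK T.D).choose_spec.1
          (exists_realising_qIdeles_pilotDataOfK T.D).choose_spec.2.1) ≤
        ((l : ℝ) + 1) / 4 * ((20 * (1 - 12 / (l : ℝ) ^ 2) - 84 / 9) * ((((2 ^ 12 * 3 ^ 3 * 5 * Cor22.dmod P : ℕ) : ℝ)) * l))) :=
  fun h => not_offRemainder_sigmaNu_le_tolSharp_at_prime M archPk archSub Ψ act Mmod region n lat sig split qData (l := 11) (by norm_num) le_rfl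
    fun P hP hcore h2 h5 h6 T => h P hP 11 (by norm_num) (by norm_num) hcore h2 h5 h6 T

end Witness

end Summit.ABC.IUTFork.Repair.RH.OffRemainderTolerance
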